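import Summits.BirchSwinnertonDyer.BirchSwinnertonDyer.Theorems.Rank2Observatory2DescMuKernel

/-!
# BirchSwinnertonDyer — rank ≥ 2 observatory: Cassels' Lemma 2 over an étale ALGEBRA (`E(F)[2] = ℤ/2` case)

HONEST FRAMING: per-curve certified theorems and census instruments; no claim on BSD in rank ≥ 2.

Generic piece (G1) of the successor instrument KERNEL-2DESC-Z2 (design
`b2b-bsdr2-cert-3/KERNEL-TRANSPORT.md` § "Successor design … KERNEL-2DESC-Z2"; the last 6 FINAL-set
rows have `E(ℚ)[2] = ℤ/2`, cubic `f = (X − e₀)·q(X)`). The tree's `…2DescMuKernel` proves Cassels'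
§15 Lemma 2 (`x − e ∈ (K^×)² ⇒ P ∈ 2E(F)`) for a root `e` in a FIELD `K ⊇ F` with `1, e, e²`
independent — i.e. `f` irreducible. For reducible `f` the same statement is needed with `K` replaced by
the étale algebra `A = F[T]/(f) ≅ F × F(θ)` and `e ↦ Θ = (e₀, θ)`, which is NOT a domain. This file
re-proves the explicit halving

* `exists_eq_two_nsmul_of_sub_eq_sq_prod` — `W : y² = x³ + a₂x² + a₄x + a₆` over a field `F` (char 0,
  elliptic), `ψ : F →+* F × K` into the PRODUCT algebra (`K` a field; not a domain), `e ∈ F × K` a root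
  of the cubic with `1, e, e²` `F`-independent, `P = (a, b) ∈ E(F)` with `ψ a − e = (p₂e² + p₁e + p₀)²`:
  then `P = 2Q`,

with Cassels' argument verbatim (it only ever compares coefficients of `1, e, e²`) except at ONE step:
the tree's proof gets `t ≠ 0` (`Q = (s₀, t)` not `2`-torsion) from "`f` has no root in `F`", false here;
instead `f(X) = (X − s₀)²(X − a) + (r₁X + r₀)²` and `t = r₁s₀ + r₀ = 0` force the double root `s₀`
of `f = (X − s₀)²(X − a + r₁²)`, contradicting `Δ(W) ≠ 0` (`ring` after substituting `a₂, a₄, a₆`).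
Applied with `K = ℚ × ℚ(√d)`, `e = (e₀, θ)` it is the `ker ψ ⊆ 2E(ℚ)` half of the complete `2`-descent
for `E(ℚ)[2] = ℤ/2` (counting half: `…2DescZ2Count.pow_finrank_add_one_le_natCard_range`).
Sorry-free; axioms `propext`, `Classical.choice`, `Quot.sound`.
[cite: Cassels1991LecturesEllipticCurves, §15 Lemma 2]
-/

-- single-conjunct summit: `Summit.BirchSwinnertonDyer.BirchSwinnertonDyer.…` repeats the name by design
set_option linter.dupNamespace false

noncomputable section

open scoped Classical

open WeierstrassCurve WeierstrassCurve.Affine WeierstrassCurve.Affine.Point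

namespace Summit.BirchSwinnertonDyer.BirchSwinnertonDyer.Rank2Observatory.TwoDescZ2

section Etale

variable {F K : Type*} [Field F] [Field K] {W : Affine F} {ψ : F →+* F × K} {e : F × K}

variable [W.IsElliptic] [CharZero F]

/-- **Cassels' Lemma 2 (explicit halving) over a product algebra `F × K`.** `W : y² = x³ + a₂x² + a₄x + a₆`
over `F`, `ψ : F →+* F × K` (`K` a field; e.g. the étale algebra `F × F(θ)` of a cubic with exactly one
root in `F`, which is NOT a domain, so the tree's field version
`TwoDescCubic.exists_eq_two_nsmul_of_sub_eq_sq` does not apply), `e ∈ F × K` a root of the cubic with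
`1, e, e²` independent over `F`, `P = (a, b) ∈ E(F)` with `a − e = (p₂e² + p₁e + p₀)²`, `pᵢ ∈ F`.
Then `P ∈ 2E(F)`. [cite: Cassels1991LecturesEllipticCurves, §15 Lemma 2] -/
theorem exists_eq_two_nsmul_of_sub_eq_sq_prod (ha₁ : W.a₁ = 0) (ha₃ : W.a₃ = 0)
    (hroot : e ^ 3 + ψ W.a₂ * e ^ 2 + ψ W.a₄ * e + ψ W.a₆ = 0)
    (hlin : ∀ c₀ c₁ c₂ : F, ψ c₂ * e ^ 2 + ψ c₁ * e + ψ c₀ = 0 → c₀ = 0 ∧ c₁ = 0 ∧ c₂ = 0)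
    {a b : F} (h : W.Nonsingular a b) {p₀ p₁ p₂ : F}
    (hsq : ψ a - e = (ψ p₂ * e ^ 2 + ψ p₁ * e + ψ p₀) ^ 2) :
    ∃ Q : W.Point, some a b h = 2 • Q := by
  have hE := h.1
  rw [equation_iff, ha₁, ha₃] at hE
  simp only [zero_mul, add_zero] at hE
  -- `hE : b ^ 2 = a ^ 3 + W.a₂ * a ^ 2 + W.a₄ * a + W.a₆`
  -- Step 1: `p₂ ≠ 0`
  have hp₂ : p₂ ≠ 0 := by
    intro h0
    rw [h0, _root_.map_zero, zero_mul, zero_add] at hsq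
    have := hlin (p₀ ^ 2 - a) (2 * p₀ * p₁ + 1) (p₁ ^ 2) (by
      simp only [map_sub, map_add, map_mul, map_pow, map_ofNat, map_one]
      linear_combination -hsq)
    have h1 : p₁ = 0 := pow_eq_zero_iff (n := 2) two_ne_zero |>.mp this.2.2
    have h2 := this.2.1
    rw [h1, mul_zero, zero_add] at h2
    exact one_ne_zero h2
  -- Step 2: `s₀, r₁, r₀` with `(s₀ − e)ρ = r₁e + r₀`
  obtain ⟨s₀, hs₀p⟩ : ∃ s₀ : F, s₀ * p₂ = p₁ - p₂ * W.a₂ :=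
    ⟨(p₁ - p₂ * W.a₂) / p₂, div_mul_cancel₀ _ hp₂⟩
  obtain ⟨r₁, hr₁⟩ : ∃ r₁ : F, r₁ = s₀ * p₁ - p₀ + p₂ * W.a₄ := ⟨_, rfl⟩
  obtain ⟨r₀, hr₀⟩ : ∃ r₀ : F, r₀ = s₀ * p₀ + p₂ * W.a₆ := ⟨_, rfl⟩
  have hlinE : (ψ s₀ - e) * (ψ p₂ * e ^ 2 + ψ p₁ * e + ψ p₀) = ψ r₁ * e + ψ r₀ := by
    have hs₀p' := congrArg ψ hs₀p
    simp only [map_mul, map_sub] at hs₀p'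
    rw [hr₁, hr₀]
    simp only [map_add, map_sub, map_mul]
    linear_combination (-(ψ p₂)) * hroot + e ^ 2 * hs₀p'
  -- Step 3: `(s₀ − e)²(a − e) = (r₁e + r₀)²`, reduced to degree ≤ 2 in `e`, gives three identities
  have hcube : (ψ s₀ - e) ^ 2 * (ψ a - e) = (ψ r₁ * e + ψ r₀) ^ 2 := by
    rw [hsq, ← hlinE]; ring
  have hco := hlin (r₀ ^ 2 - a * s₀ ^ 2 - W.a₆) (2 * r₀ * r₁ + 2 * a * s₀ + s₀ ^ 2 - W.a₄)
    (r₁ ^ 2 - a - 2 * s₀ - W.a₂) (by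
      simp only [map_sub, map_add, map_mul, map_pow, map_ofNat]
      linear_combination -hcube - hroot)
  obtain ⟨h6, h4, h2⟩ := hco
  -- `a₂ = r₁² − a − 2s₀`, `a₄ = 2r₀r₁ + 2as₀ + s₀²`, `a₆ = r₀² − a s₀²`
  -- Step 4: `Q = (s₀, t)`, `t = r₁s₀ + r₀`, lies on `W`, and is not `2`-torsion
  obtain ⟨t, ht⟩ : ∃ t : F, t = r₁ * s₀ + r₀ := ⟨_, rfl⟩
  have hQE : W.Equation s₀ t := by
    rw [equation_iff, ha₁, ha₃]
    simp only [zero_mul, add_zero]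
    rw [ht]
    linear_combination s₀ ^ 2 * h2 + s₀ * h4 + h6
  have hQ : W.Nonsingular s₀ t := equation_iff_nonsingular.mp hQE
  -- `t ≠ 0` from SEPARABILITY (not from irreducibility, which fails when `E(F)[2] ≠ 0`):
  -- `f(X) = (X − s₀)²(X − a) + (r₁X + r₀)²`, so `t = r₁s₀ + r₀ = 0` would make `s₀` a double root
  -- of `f = (X − s₀)²(X − a + r₁²)`, i.e. `Δ(W) = 16·disc f = 0`.
  have ht0 : t ≠ 0 := by
    intro h0
    have hr₀' : r₀ = -(r₁ * s₀) := by linear_combination h0 - ht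
    have ea₂ : W.a₂ = r₁ ^ 2 - a - 2 * s₀ := by linear_combination -h2
    have ea₄ : W.a₄ = 2 * r₀ * r₁ + 2 * a * s₀ + s₀ ^ 2 := by linear_combination -h4
    have ea₆ : W.a₆ = r₀ ^ 2 - a * s₀ ^ 2 := by linear_combination -h6
    have hΔ : W.Δ = 0 := by
      rw [WeierstrassCurve.Δ, WeierstrassCurve.b₂, WeierstrassCurve.b₄, WeierstrassCurve.b₆,
        WeierstrassCurve.b₈, ha₁, ha₃, ea₂, ea₄, ea₆, hr₀']
      ring
    exact W.isUnit_Δ.ne_zero hΔ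
  have hneg : W.negY s₀ t = -t := by rw [negY, ha₁, ha₃]; ring
  have hty : t ≠ W.negY s₀ t := by
    rw [hneg]; intro h0
    exact ht0 (by linear_combination h0 / 2)
  -- the tangent slope at `Q` is `r₁` and `x(2Q) = a`
  have hsl : W.slope s₀ s₀ t t = r₁ := by
    rw [slope_of_Y_ne rfl hty, hneg, ha₁]
    have h2t : t - -t ≠ 0 := by
      rw [sub_neg_eq_add, ← two_mul]; exact mul_ne_zero two_ne_zero ht0
    rw [div_eq_iff h2t]
    linear_combination (-2 * s₀) * h2 - h4 - 2 * r₁ * ht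
  have hx2 : W.addX s₀ s₀ (W.slope s₀ s₀ t t) = a := by
    rw [hsl, addX, ha₁]
    linear_combination h2
  -- Step 5: `2Q = (a, ±b)`
  have h2Q : (some s₀ t hQ : W.Point) + some s₀ t hQ =
      some (W.addX s₀ s₀ (W.slope s₀ s₀ t t)) (W.addY s₀ s₀ t (W.slope s₀ s₀ t t))
        (nonsingular_add hQ hQ fun hxy => hty hxy.right) := add_self_of_Y_ne hty
  set y₃ := W.addY s₀ s₀ t (W.slope s₀ s₀ t t) with hy₃
  have h₃ : W.Nonsingular (W.addX s₀ s₀ (W.slope s₀ s₀ t t)) y₃ :=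
    nonsingular_add hQ hQ fun hxy => hty hxy.right
  have h₃' : W.Nonsingular a y₃ := hx2 ▸ h₃
  have h2Q' : (some s₀ t hQ : W.Point) + some s₀ t hQ = some a y₃ h₃' := by
    rw [h2Q]
    congr 1
  rcases Y_eq_of_X_eq h₃'.1 h.1 rfl with hy | hy
  · refine ⟨some s₀ t hQ, ?_⟩
    rw [two_nsmul, h2Q']
    congr 1
    exact hy.symm
  · refine ⟨-some s₀ t hQ, ?_⟩
    rw [two_nsmul, ← neg_add, h2Q', neg_some]
    congr 1
    rw [hy, negY_negY]

end Etale

/-! ### G2′ — the quadratic case `E_{a,b} : y² = x³ + a x² + b x`, `K = ℚ(θ)`, `θ² + aθ + b = 0`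

For the rows with `E(ℚ)[2] = ℤ/2` the cubic is `X·(X² + aX + b)`; the descent map is the tree's
`μ_θ : (x, y) ↦ (x − θ)·(K^×)²` over the QUADRATIC field `K` alone, and its kernel is still `2E(ℚ)`:
`x − θ = (p + qθ)²` forces `x = p² − bq²`, `2pq − aq² = −1`, hence `x² + ax + b = N²` with
`N = p² − apq + bq²` and `x = (y/N)²`; then `(x, x − θ) = (y/N, p + qθ)²` in the étale algebra
`A = ℚ × K` with `Θ = (0, θ)` and the product-algebra form of Cassels' Lemma 2 above applies. -/

section Quadratic

variable {F K : Type*} [Field F] [Field K] {W : Affine F} {φ : F →+* K} {θ : K} {a b : F}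

/-- `θ ∉ φ(F)` when `1, θ` are independent. [folklore] -/
theorem ne_of_linIndep₂ (hlinK : ∀ c₀ c₁ : F, φ c₁ * θ + φ c₀ = 0 → c₀ = 0 ∧ c₁ = 0) (x : F) :
    φ x ≠ θ := by
  intro h
  have := hlinK (-x) 1 (by rw [map_one, one_mul, map_neg, h, add_neg_cancel])
  exact one_ne_zero this.2

/-- `1, Θ, Θ²` are `F`-independent in `A = F × K` for `Θ = (0, θ)`, `θ² + aθ + b = 0`, `b ≠ 0`,
`1, θ` independent in `K`. [folklore] -/
theorem powIndep_prod (hq : θ ^ 2 + φ a * θ + φ b = 0) (hb : b ≠ 0)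
    (hlinK : ∀ c₀ c₁ : F, φ c₁ * θ + φ c₀ = 0 → c₀ = 0 ∧ c₁ = 0) :
    ∀ c₀ c₁ c₂ : F, ((RingHom.id F).prod φ) c₂ * ((0 : F), θ) ^ 2 +
      ((RingHom.id F).prod φ) c₁ * ((0 : F), θ) + ((RingHom.id F).prod φ) c₀ = 0 →
      c₀ = 0 ∧ c₁ = 0 ∧ c₂ = 0 := by
  intro c₀ c₁ c₂ h
  rw [Prod.ext_iff] at h
  obtain ⟨h1, h2⟩ := h
  simp only [RingHom.prod_apply, RingHom.id_apply, Prod.fst_add, Prod.fst_mul, Prod.pow_fst,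
    Prod.fst_zero, Prod.snd_add, Prod.snd_mul, Prod.pow_snd, Prod.snd_zero] at h1 h2
  have hc₀ : c₀ = 0 := by linear_combination h1
  have := hlinK (c₀ - b * c₂) (c₁ - a * c₂) (by
    simp only [map_sub, map_mul]
    linear_combination h2 - (φ c₂) * hq)
  obtain ⟨h3, h4⟩ := this
  have hc₂ : c₂ = 0 := by
    have : b * c₂ = 0 := by linear_combination hc₀ - h3
    exact (mul_eq_zero.mp this).resolve_left hb
  exact ⟨hc₀, by linear_combination h4 + a * hc₂, hc₂⟩

variable [W.IsElliptic] [CharZero F]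

/-- **`ker μ_θ ⊆ 2E(F)` for `E_{a,b} : y² = x³ + ax² + bx`.** `θ ∈ K` with `θ² + aθ + b = 0` and
`1, θ` independent over `F` (`K ⊇ F(θ)` the quadratic field of the irreducible factor),
`P = (x, y) ∈ E(F)` with `x − θ = (qθ + p)²`, `p, q ∈ F`. Then `P ∈ 2E(F)`.
[cite: Cassels1991LecturesEllipticCurves, §15 Lemma 2] -/
theorem exists_eq_two_nsmul_of_sub_theta_eq_sq (ha₁ : W.a₁ = 0) (ha₃ : W.a₃ = 0)
    (ha₂ : W.a₂ = a) (ha₄ : W.a₄ = b) (ha₆ : W.a₆ = 0) (hq : θ ^ 2 + φ a * θ + φ b = 0)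
    (hlinK : ∀ c₀ c₁ : F, φ c₁ * θ + φ c₀ = 0 → c₀ = 0 ∧ c₁ = 0)
    {x y : F} (h : W.Nonsingular x y) {p q : F} (hsq : φ x - θ = (φ q * θ + φ p) ^ 2) :
    ∃ Q : W.Point, some x y h = 2 • Q := by
  have hne := ne_of_linIndep₂ hlinK
  -- `b ≠ 0` from `Δ(E_{a,b}) = 16 b² (a² − 4b) ≠ 0`
  have hb : b ≠ 0 := by
    intro hb0
    apply W.isUnit_Δ.ne_zero
    rw [WeierstrassCurve.Δ, WeierstrassCurve.b₂, WeierstrassCurve.b₄, WeierstrassCurve.b₆,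
      WeierstrassCurve.b₈, ha₁, ha₃, ha₂, ha₄, ha₆, hb0]
    ring
  have hE := h.1
  rw [equation_iff, ha₁, ha₃, ha₂, ha₄, ha₆] at hE
  simp only [zero_mul, add_zero] at hE
  -- `hE : y ^ 2 = x ^ 3 + a * x ^ 2 + b * x`
  -- compare coefficients of `1, θ` in `hsq`: `x = p² − bq²`, `2pq − aq² = −1`
  have hco := hlinK (p ^ 2 - b * q ^ 2 - x) (2 * p * q - a * q ^ 2 + 1) (by
    simp only [map_sub, map_add, map_mul, map_pow, map_ofNat, map_one]
    linear_combination -hsq - (φ q) ^ 2 * hq)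
  obtain ⟨hx, hr⟩ := hco
  have hx' : x = p ^ 2 - b * q ^ 2 := by linear_combination -hx
  -- `x² + ax + b = N²`, `N = p² − apq + bq²`
  set N := p ^ 2 - a * p * q + b * q ^ 2 with hN
  have hqx : x ^ 2 + a * x + b = N ^ 2 := by
    rw [hx', hN]
    linear_combination (a * p ^ 2 - 2 * b * p * q + b) * hr
  -- `N ≠ 0`: else `x` is a rational root of `X² + aX + b = (X − θ)(X − θ')`
  have hN0 : N ≠ 0 := by
    intro h0
    have hq0 : x ^ 2 + a * x + b = 0 := by rw [hqx, h0]; ring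
    have hq0' := congrArg φ hq0
    simp only [map_add, map_mul, map_pow, _root_.map_zero] at hq0'
    have hfac : (θ - φ x) * (θ - φ (-a - x)) = 0 := by
      simp only [map_neg, map_sub]
      linear_combination hq - hq0'
    rcases mul_eq_zero.mp hfac with h1 | h1
    · exact hne x (sub_eq_zero.mp h1).symm
    · exact hne (-a - x) (sub_eq_zero.mp h1).symm
  -- `x = (y / N)²`
  set u := y / N with hu
  have hxsq : x = u ^ 2 := by
    rw [hu, div_pow, eq_div_iff (pow_ne_zero 2 hN0), hE, ← hqx]
    ring
  -- the square in `A = F × K`, `Θ = (0, θ)`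
  have hrootA : ((0 : F), θ) ^ 3 + ((RingHom.id F).prod φ) W.a₂ * ((0 : F), θ) ^ 2 +
      ((RingHom.id F).prod φ) W.a₄ * ((0 : F), θ) + ((RingHom.id F).prod φ) W.a₆ = 0 := by
    rw [ha₂, ha₄, ha₆, Prod.ext_iff]
    simp only [RingHom.prod_apply, RingHom.id_apply, Prod.fst_add, Prod.fst_mul, Prod.pow_fst,
      Prod.fst_zero, Prod.snd_add, Prod.snd_mul, Prod.pow_snd, Prod.snd_zero, _root_.map_zero]
    exact ⟨by ring, by linear_combination θ * hq⟩
  have hc : φ ((u - p) / b) * φ b = φ u - φ p := by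
    rw [← map_mul, div_mul_cancel₀ _ hb, map_sub]
  have hsqA : ((RingHom.id F).prod φ) x - ((0 : F), θ) =
      (((RingHom.id F).prod φ) ((u - p) / b) * ((0 : F), θ) ^ 2 +
        ((RingHom.id F).prod φ) (q + a * ((u - p) / b)) * ((0 : F), θ) +
        ((RingHom.id F).prod φ) u) ^ 2 := by
    rw [Prod.ext_iff]
    simp only [RingHom.prod_apply, RingHom.id_apply, Prod.fst_sub, Prod.fst_add, Prod.fst_mul,
      Prod.pow_fst, Prod.snd_sub, Prod.snd_add, Prod.snd_mul, Prod.pow_snd]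
    refine ⟨by rw [hxsq]; ring, ?_⟩
    have key : φ ((u - p) / b) * θ ^ 2 + φ (q + a * ((u - p) / b)) * θ + φ u =
        φ q * θ + φ p + φ ((u - p) / b) * (θ ^ 2 + φ a * θ + φ b) := by
      simp only [map_add, map_mul]
      linear_combination -hc
    rw [key, hq, mul_zero, add_zero, ← hsq]
  exact exists_eq_two_nsmul_of_sub_eq_sq_prod ha₁ ha₃ hrootA (powIndep_prod hq hb hlinK) h hsqA

end Quadratic

end Summit.BirchSwinnertonDyer.BirchSwinnertonDyer.Rank2Observatory.TwoDescZ2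

end
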